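import Summits.MatrixMultiplication.MatrixMultiplication.Theorems.AbelianSTPPCensusVPCertSemantics

/-!
# vP certificate, soundness of the `VPCert` checker (part 2: the invariant `AboveV`, tail budgets, the Δ4 completion budget)

`AboveV M G fam` = eng-2's `Above` for vP records + the hereditary vP field `vp : ∀ L ≤ G, U11GM M L ∧ (M.Prime → U11PM M L)`;
the tail lemmas of `…ShapeCertBudgets` re-proved for `shOfV` records; and the COMPLETION BUDGET (Δ4, REF [104]/[106]):
`AboveV.tail_uu_le_qTot` — the tail's packing weight `Σ(ab+bc+ca)` of any vP-admissible family above the prefix whose tail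
lies in the pool is at most `qTot` (eng-2's `q0` sharpened by every gated Grynkiewicz / Pollard budget).  Acceptance criteria
[106]: (i) the gate is `t > max(prefix max, pool decoration)` per form letter (`tokG`/`tokP`); (ii) `hb` is discharged by
`AboveV.sides_le` = prefix maxima + SUFFIX MEMBERSHIP (`sufDec_side`), no sort-order lemma; (iii) `hG`/`hP` come from the family's
admissibility (`AboveV.vpG`), `hCA` from the packing conjunct `AdmM.1`, `3 ≤ t` / `1 ≤ t` and the fibre gate `t ≤ L_r(prefix)`
from the node test; (iv) `sufDec_side` (part 1).
Cell mm-stpp, seat mm-stpp-vp-p2 (gen 0), 2026-08-26.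
-/

set_option linter.dupNamespace false
set_option autoImplicit false

namespace Summit.MatrixMultiplication.MatrixMultiplication.Theorems.VPCert

open ShapeCert Multiset

section above
/-! ### The tail of a vP-admissible family above a prefix -/

variable {M : ℕ} {G : Multiset (ℕ × ℕ × ℕ)} {fam : List Sh}

/-- Standing hypotheses of the search: a `vM`-admissible family `G` inside the universe whose every realised sub-list
passes U11-G (and U11-P when `M` is prime) — hereditary by construction — above the well-formed prefix `fam`. -/
structure AboveV (M : ℕ) (G : Multiset (ℕ × ℕ × ℕ)) (fam : List Sh) : Prop where
  univ : ∀ x ∈ G, InUniv M x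
  adm : AdmM M G
  vp : ∀ L : List (ℕ × ℕ × ℕ), (L : Multiset (ℕ × ℕ × ℕ)) ≤ G → U11GM M L ∧ (M.Prime → U11PM M L)
  wf : WfV M fam
  le : famT fam ≤ G

/-- prefix members belong to the family -/
theorem AboveV.mem_G (h : AboveV M G fam) {t : Sh} (ht : t ∈ fam) : t.tr ∈ G :=
  Multiset.mem_of_le h.le (tr_mem_famT ht)

/-- the whole family passes U11-G, and U11-P at prime orders -/
theorem AboveV.vpG (h : AboveV M G fam) : U11GM M G ∧ (M.Prime → U11PM M G) := by
  obtain ⟨L, hL⟩ := Quot.exists_rep G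
  have := h.vp L (le_of_eq hL)
  rw [show (L : Multiset (ℕ × ℕ × ℕ)) = G from hL] at this
  exact this

/-- a member of the family is a prefix member or a tail member -/
theorem AboveV.mem_split (h : AboveV M G fam) {x : ℕ × ℕ × ℕ} (hx : x ∈ G) : x ∈ famT fam ∨ x ∈ G - famT fam := by
  have hG : G = famT fam + (G - famT fam) := by rw [add_comm, Multiset.sub_add_cancel h.le]
  rw [hG] at hx; exact Multiset.mem_add.mp hx

/-- U11: the tail's `Σ a(b+c)` fits the prefix's budget -/
theorem AboveV.tail_wa (h : AboveV M G fam) : ((G - famT fam).map wa).sum + sA fam ≤ M + mnA fam M := by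
  have hs := sum_map_split h.le wa
  rw [sA_eqV h.wf, add_comm, ← hs]
  apply le_add_mnA
  · rcases Multiset.empty_or_exists_mem G with hG | ⟨x, hx⟩
    · subst hG; simp
    · exact (h.adm.2.1 x hx).1.trans (by have := (h.univ x hx).a_le; omega)
  · intro t ht; have := (h.adm.2.1 t.tr (h.mem_G ht)).1; rwa [tr_fst] at this

/-- U11: the tail's `Σ b(c+a)` fits the prefix's budget -/
theorem AboveV.tail_wb (h : AboveV M G fam) : ((G - famT fam).map wb).sum + sB fam ≤ M + mnB fam M := by
  have hs := sum_map_split h.le wb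
  rw [sB_eqV h.wf, add_comm, ← hs]
  apply le_add_mnB
  · rcases Multiset.empty_or_exists_mem G with hG | ⟨x, hx⟩
    · subst hG; simp
    · exact (h.adm.2.1 x hx).2.1.trans (by have := (h.univ x hx).b_le; omega)
  · intro t ht; have := (h.adm.2.1 t.tr (h.mem_G ht)).2.1; rwa [tr_snd] at this

/-- U11: the tail's `Σ c(a+b)` fits the prefix's budget -/
theorem AboveV.tail_wc (h : AboveV M G fam) : ((G - famT fam).map wc).sum + sC fam ≤ M + mnC fam M := by
  have hs := sum_map_split h.le wc
  rw [sC_eqV h.wf, add_comm, ← hs]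
  apply le_add_mnC
  · rcases Multiset.empty_or_exists_mem G with hG | ⟨x, hx⟩
    · subst hG; simp
    · exact (h.adm.2.1 x hx).2.2.trans (by have := (h.univ x hx).c_le; omega)
  · intro t ht; have := (h.adm.2.1 t.tr (h.mem_G ht)).2.2; rwa [tr_thd] at this

/-- the erased-sum decomposition at a prefix member -/
theorem AboveV.erase_split (h : AboveV M G fam) {t : Sh} (ht : t ∈ fam) (f : ℕ × ℕ × ℕ → ℕ) :
    ((G.erase t.tr).map f).sum + f t.tr = ((famT fam).map f).sum + ((G - famT fam).map f).sum := by
  have hmem := tr_mem_famT (fam := fam) ht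
  have hG : G = famT fam + (G - famT fam) := by rw [add_comm, Multiset.sub_add_cancel h.le]
  have h1 : G.erase t.tr = (famT fam).erase t.tr + (G - famT fam) := by
    conv_lhs => rw [hG]
    exact Multiset.erase_add_left_pos _ hmem
  have h2 : ((famT fam).map f).sum = f t.tr + (((famT fam).erase t.tr).map f).sum := by
    conv_lhs => rw [← Multiset.cons_erase hmem]
    simp
  rw [h1, h2]; simp; ring

/-- U14 (`ab`): the tail's `Σ ab` fits under the prefix's largest offset -/
theorem AboveV.tail_pab (h : AboveV M G fam) : ((G - famT fam).map pab).sum + dAB fam + sab fam ≤ M := by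
  have hs := sum_map_split h.le pab
  have h2 : (G.map pab).sum ≤ M := h.adm.1.1
  rw [sab_eqV h.wf]; unfold pabM
  have key : ∀ t ∈ fam, t.dab + ((famT fam).map pab).sum + ((G - famT fam).map pab).sum ≤ M := by
    intro t ht
    have hx := h.mem_G ht
    obtain ⟨⟨a1, a2⟩, -, -⟩ := h.adm.2.2.2.1 t.tr hx
    have hsp := h.erase_split ht pab
    have hpv := (h.univ _ hx).pab_le_vol
    rw [h.wf t ht, shOfV_dab]
    by_cases hl : hasLCD (vol t.tr) M t.tr.2.2 = true
    · rw [if_pos hl]; omega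
    · rw [if_neg hl]
      have : vol t.tr + ((G.erase t.tr).map pab).sum ≠ M := fun he => hl (a2 he)
      omega
  have hd : dAB fam ≤ M - (((famT fam).map pab).sum + ((G - famT fam).map pab).sum) :=
    dAB_le fun t ht => by have := key t ht; omega
  omega

/-- U14 (`bc`): the tail's `Σ bc` fits under the prefix's largest offset -/
theorem AboveV.tail_pbc (h : AboveV M G fam) : ((G - famT fam).map pbc).sum + dBC fam + sbc fam ≤ M := by
  have hs := sum_map_split h.le pbc
  have h2 : (G.map pbc).sum ≤ M := h.adm.1.2.1
  rw [sbc_eqV h.wf]; unfold pbcM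
  have key : ∀ t ∈ fam, t.dbc + ((famT fam).map pbc).sum + ((G - famT fam).map pbc).sum ≤ M := by
    intro t ht
    have hx := h.mem_G ht
    obtain ⟨-, ⟨b1, b2⟩, -⟩ := h.adm.2.2.2.1 t.tr hx
    have hsp := h.erase_split ht pbc
    have hpv := (h.univ _ hx).pbc_le_vol
    rw [h.wf t ht, shOfV_dbc]
    by_cases hl : hasLCD (vol t.tr) M t.tr.1 = true
    · rw [if_pos hl]; omega
    · rw [if_neg hl]
      have : vol t.tr + ((G.erase t.tr).map pbc).sum ≠ M := fun he => hl (b2 he)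
      omega
  have hd : dBC fam ≤ M - (((famT fam).map pbc).sum + ((G - famT fam).map pbc).sum) :=
    dBC_le fun t ht => by have := key t ht; omega
  omega

/-- U14 (`ca`): the tail's `Σ ca` fits under the prefix's largest offset -/
theorem AboveV.tail_pca (h : AboveV M G fam) : ((G - famT fam).map pca).sum + dCA fam + sca fam ≤ M := by
  have hs := sum_map_split h.le pca
  have h2 : (G.map pca).sum ≤ M := h.adm.1.2.2
  rw [sca_eqV h.wf]; unfold pcaM
  have key : ∀ t ∈ fam, t.dca + ((famT fam).map pca).sum + ((G - famT fam).map pca).sum ≤ M := by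
    intro t ht
    have hx := h.mem_G ht
    obtain ⟨-, -, ⟨c1, c2⟩⟩ := h.adm.2.2.2.1 t.tr hx
    have hsp := h.erase_split ht pca
    have hpv := (h.univ _ hx).pca_le_vol
    rw [h.wf t ht, shOfV_dca]
    by_cases hl : hasLCD (vol t.tr) M t.tr.2.1 = true
    · rw [if_pos hl]; omega
    · rw [if_neg hl]
      have : vol t.tr + ((G.erase t.tr).map pca).sum ≠ M := fun he => hl (c2 he)
      omega
  have hd : dCA fam ≤ M - (((famT fam).map pca).sum + ((G - famT fam).map pca).sum) :=
    dCA_le fun t ht => by have := key t ht; omega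
  omega

/-- volume cap: a tail member leaves room for the prefix's pair-product sums and largest pair product -/
theorem AboveV.tail_vol (h : AboveV M G fam) {x : ℕ × ℕ × ℕ} (hx : x ∈ G - famT fam) :
    vol x + sab fam ≤ M ∧ vol x + sbc fam ≤ M ∧ vol x + sca fam ≤ M ∧ vol x + mxP fam ≤ M := by
  have hxG := mem_G_of_tail hx
  have hle := le_erase_of_mem_sub h.le hx
  obtain ⟨⟨a1, -⟩, ⟨b1, -⟩, ⟨c1, -⟩⟩ := h.adm.2.2.2.1 x hxG
  have e1 := sum_map_le_of_le hle pab
  have e2 := sum_map_le_of_le hle pbc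
  have e3 := sum_map_le_of_le hle pca
  have f1 := sab_eqV h.wf; have f2 := sbc_eqV h.wf; have f3 := sca_eqV h.wf
  unfold pabM at f1; unfold pbcM at f2; unfold pcaM at f3
  rw [← f1] at e1; rw [← f2] at e2; rw [← f3] at e3
  have hv : vol x ≤ M := by have := (h.univ x hxG).vol_le; omega
  have e4 : mxP fam ≤ M - vol x := mxP_le fun t ht => by
    have h9 := h.adm.2.2.1 t.tr (h.mem_G ht) x (mem_erase_of_mem_sub h.le hx (tr_mem_famT ht))
    have hm := congrArg Sh.mpp (h.wf t ht); rw [shOfV_mpp] at hm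
    omega
  omega

/-- a dead prefix has no tail -/
theorem AboveV.tail_eq_zero_of_dead (h : AboveV M G fam) (hd : (aggOf M fam).dead M = true) :
    G - famT fam = 0 := by
  rcases Multiset.empty_or_exists_mem (G - famT fam) with h0 | ⟨x, hx⟩
  · exact h0
  exfalso
  have hxG := mem_G_of_tail hx
  have hU := h.univ x hxG
  have w1 := Multiset.le_sum_of_mem (Multiset.mem_map_of_mem wa hx)
  have w2 := Multiset.le_sum_of_mem (Multiset.mem_map_of_mem wb hx)
  have w3 := Multiset.le_sum_of_mem (Multiset.mem_map_of_mem wc hx)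
  have t1 := h.tail_wa; have t2 := h.tail_wb; have t3 := h.tail_wc
  obtain ⟨v1, v2, v3, v4⟩ := h.tail_vol hx
  have := hU.two_le_wa; have := hU.two_le_wb; have := hU.two_le_wc; have := hU.one_le_vol
  unfold Agg.dead Agg.ra Agg.rb Agg.rc Agg.vl Agg.mc aggOf at hd
  simp only [decide_eq_true_eq] at hd
  rcases hd with hd | hd | hd | hd
  · omega
  · omega
  · omega
  · have hm : max (max (sab fam) (max (sbc fam) (sca fam))) (mxP fam) ≤ M - vol x :=
      max_le (max_le (by omega) (max_le (by omega) (by omega))) (by omega)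
    omega

/-- the tail's packing weight fits eng-2's budget `q0` (U14 budget ∧ half the U11 budget) -/
theorem AboveV.tail_uu (h : AboveV M G fam) : ((G - famT fam).map uu).sum ≤ (aggOf M fam).q0 M := by
  have p1 := h.tail_pab; have p2 := h.tail_pbc; have p3 := h.tail_pca
  have t1 := h.tail_wa; have t2 := h.tail_wb; have t3 := h.tail_wc
  have e1 := sum_uu_eq (G - famT fam); have e2 := sum_w_eq (G - famT fam)
  unfold Agg.q0 Agg.ra Agg.rb Agg.rc aggOf
  simp only
  refine le_min (by omega) ?_
  rw [Nat.le_div_iff_mul_le (by norm_num)]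
  omega

end above

section budget
/-! ### Δ4: the completion budget -/

variable {M : ℕ} {G : Multiset (ℕ × ℕ × ℕ)} {fam : List Sh}

/-- every side of every member of the family is below the prefix maximum or the pool decoration -/
theorem AboveV.sides_le (h : AboveV M G fam) {R : List Sh} (hR : ∀ x ∈ G - famT fam, shOfV M x ∈ R)
    {x : ℕ × ℕ × ℕ} (hx : x ∈ G) :
    x.1 ≤ max (mxaL fam) (headD (sufDec R)).ma ∧ x.2.1 ≤ max (mxbL fam) (headD (sufDec R)).mb ∧
      x.2.2 ≤ max (mxcL fam) (headD (sufDec R)).mc := by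
  rcases h.mem_split hx with hx | hx
  · obtain ⟨t, ht, rfl⟩ := mem_famT hx
    exact ⟨(le_mxaL ht).trans (le_max_left _ _), (le_mxbL ht).trans (le_max_left _ _),
      (le_mxcL ht).trans (le_max_left _ _)⟩
  · obtain ⟨h1, h2, h3⟩ := sufDec_side R _ (hR x hx)
    rw [shOfV_a] at h1; rw [shOfV_b] at h2; rw [shOfV_c] at h3
    exact ⟨h1.trans (le_max_right _ _), h2.trans (le_max_right _ _), h3.trans (le_max_right _ _)⟩

/-- the tail's `3·ΣV` is at most `ms · Σ(ab+bc+ca)`, `ms` the pool's largest side -/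
theorem tail_sv_le {R : List Sh} (hR : ∀ x ∈ G - famT fam, shOfV M x ∈ R) :
    3 * svM (G - famT fam) ≤ (headD (sufDec R)).ms * ((G - famT fam).map uu).sum := by
  unfold svM
  rw [← Multiset.sum_map_mul_left, ← Multiset.sum_map_mul_left]
  refine Multiset.sum_map_le_sum_map _ _ fun x hx => ?_
  obtain ⟨h1, h2, h3⟩ := sufDec_ms (hR x hx)
  rw [shOfV_a] at h1; rw [shOfV_b] at h2; rw [shOfV_c] at h3
  exact three_vol_le h1 h2 h3

/-- from the U11-G core over the whole family to the tail's packing budget `qG1` -/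
theorem AboveV.tail_uu_of_coreG (h : AboveV M G fam) {R : List Sh} (hR : ∀ x ∈ G - famT fam, shOfV M x ∈ R)
    {t : ℕ} (hms : (headD (sufDec R)).ms < 3 * t)
    (hcore : t * (pabM G + pbcM G + pcaM G) + 1 ≤ 2 * t ^ 2 + t * M + svM G) :
    ((G - famT fam).map uu).sum ≤ (aggV M fam).qG1 (headD (sufDec R)) M t := by
  unfold AggV.qG1 AggV.U aggV; simp only [aggOf]
  rw [sab_eqV h.wf, sbc_eqV h.wf, sca_eqV h.wf, sv_eqV h.wf]
  have hsplit := fun f => sum_map_split h.le f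
  have e1 := hsplit pab; have e2 := hsplit pbc; have e3 := hsplit pca; have e4 := hsplit vol
  have eu := sum_uu_eq (G - famT fam)
  have hsv := tail_sv_le hR
  unfold pabM pbcM pcaM svM at *
  refine uu_le_div hms ?_ hsv
  nlinarith [hcore, e1, e2, e3, e4, eu]

/-- from the U11-P core over the whole family to the tail's packing budget `qP1` -/
theorem AboveV.tail_uu_of_coreP (h : AboveV M G fam) {R : List Sh} (hR : ∀ x ∈ G - famT fam, shOfV M x ∈ R)
    {t : ℕ} (hms : (headD (sufDec R)).ms < 3 * t)
    (hcore : t * (pabM G + pbcM G + pcaM G) ≤ t ^ 2 + t * M + svM G) :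
    ((G - famT fam).map uu).sum ≤ (aggV M fam).qP1 (headD (sufDec R)) M t := by
  unfold AggV.qP1 AggV.U aggV; simp only [aggOf]
  rw [sab_eqV h.wf, sbc_eqV h.wf, sca_eqV h.wf, sv_eqV h.wf]
  have hsplit := fun f => sum_map_split h.le f
  have e1 := hsplit pab; have e2 := hsplit pbc; have e3 := hsplit pca; have e4 := hsplit vol
  have eu := sum_uu_eq (G - famT fam)
  have hsv := tail_sv_le hR
  unfold pabM pbcM pcaM svM at *
  have := @uu_le_div t (headD (sufDec R)).ms ((Multiset.map pab (famT fam)).sum +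
    (Multiset.map pbc (famT fam)).sum + (Multiset.map pca (famT fam)).sum) ((G - famT fam).map uu).sum
    (t ^ 2 + t * M + (Multiset.map vol (famT fam)).sum) (Multiset.map vol (G - famT fam)).sum 0 hms
    (by nlinarith [hcore, e1, e2, e3, e4, eu]) hsv
  simpa using this

/-- prefix values are below the family's: `Σab` -/
theorem AboveV.sab_le (h : AboveV M G fam) : sab fam ≤ pabM G := by
  rw [sab_eqV h.wf]; exact sum_map_le_of_le h.le pab
/-- prefix values are below the family's: `Σbc` -/
theorem AboveV.sbc_le (h : AboveV M G fam) : sbc fam ≤ pbcM G := by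
  rw [sbc_eqV h.wf]; exact sum_map_le_of_le h.le pbc
/-- prefix values are below the family's: `Σca` -/
theorem AboveV.sca_le (h : AboveV M G fam) : sca fam ≤ pcaM G := by
  rw [sca_eqV h.wf]; exact sum_map_le_of_le h.le pca
/-- prefix values are below the family's: fibre sum A -/
theorem AboveV.la_le (h : AboveV M G fam) : laL fam ≤ laM G := by
  rw [la_eqV h.wf]; exact sum_map_le_of_le h.le _
/-- prefix values are below the family's: fibre sum B -/
theorem AboveV.lb_le (h : AboveV M G fam) : lbL fam ≤ lbM G := by
  rw [lb_eqV h.wf]; exact sum_map_le_of_le h.le _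
/-- prefix values are below the family's: fibre sum C -/
theorem AboveV.lc_le (h : AboveV M G fam) : lcL fam ≤ lcM G := by
  rw [lc_eqV h.wf]; exact sum_map_le_of_le h.le _
/-- a nonempty prefix forces `P_CA ≥ 1` -/
theorem AboveV.one_le_pcaM (h : AboveV M G fam) {s : Sh} (hs : s ∈ fam) : 1 ≤ pcaM G := by
  have hx := h.mem_G hs
  obtain ⟨ha, -, hc⟩ := (h.univ _ hx).pos
  have : pca s.tr ≤ pcaM G := Multiset.le_sum_of_mem (Multiset.mem_map_of_mem pca hx)
  unfold pca at this; nlinarith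

/-- middle letters of the rotated families -/
theorem mem_rotA_lt {t : ℕ} (hb : ∀ x ∈ G, x.1 < t) : ∀ x ∈ G.map rotA, x.2.1 < t := by
  intro x hx; obtain ⟨y, hy, rfl⟩ := Multiset.mem_map.mp hx; exact hb y hy
/-- middle letters of the rotated families -/
theorem mem_rotC_lt {t : ℕ} (hb : ∀ x ∈ G, x.2.2 < t) : ∀ x ∈ G.map rotC, x.2.1 < t := by
  intro x hx; obtain ⟨y, hy, rfl⟩ := Multiset.mem_map.mp hx; exact hb y hy

/-- **the U11-G budget** (Δ4): for every gated `t`, the tail's packing weight is below `qG1` -/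
theorem AboveV.tail_uu_le_qG1 (h : AboveV M G fam) {R : List Sh} (hR : ∀ x ∈ G - famT fam, shOfV M x ∈ R)
    {t : ℕ} (ht : (aggV M fam).tokG (headD (sufDec R)) t = true) :
    ((G - famT fam).map uu).sum ≤ (aggV M fam).qG1 (headD (sufDec R)) M t := by
  unfold AggV.tokG at ht
  simp only [Bool.and_eq_true, Bool.or_eq_true, decide_eq_true_eq] at ht
  obtain ⟨hms, hr⟩ := ht
  refine h.tail_uu_of_coreG hR hms ?_
  have hGM := h.vpG.1
  have hpk := h.adm.1
  rcases hr with (⟨hlo, hhi⟩ | ⟨hlo, hhi⟩) | ⟨hlo, hhi⟩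
  · -- form A: letters `(c, a, b)`, middle letter `a`
    unfold AggV.tloA aggV at hlo; unfold AggV.thiA aggV at hhi; simp only [aggOf] at hlo hhi
    have hb : ∀ x ∈ G, x.1 < t := fun x hx => by have := (h.sides_le hR hx).1; omega
    have h1 := h.sab_le; have h2 := h.sca_le; have h3 := h.la_le
    have hc := budget_coreG hGM.2.1 (by rw [pcaM_rotA]; exact hpk.2.1) (by omega)
      (by rw [pabM_rotA]; omega) (by rw [pbcM_rotA]; omega)
      (by rw [lBM_eq_of_lt (mem_rotA_lt hb), lbM_rotA]; omega) (mem_rotA_lt hb)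
    rw [pabM_rotA, pbcM_rotA, pcaM_rotA, svM_rotA] at hc
    nlinarith [hc]
  · -- form B
    unfold AggV.tloB aggV at hlo; unfold AggV.thiB aggV at hhi; simp only [aggOf] at hlo hhi
    have hb : ∀ x ∈ G, x.2.1 < t := fun x hx => by have := (h.sides_le hR hx).2.1; omega
    have h1 := h.sab_le; have h2 := h.sbc_le; have h3 := h.lb_le
    exact budget_coreG hGM.1 hpk.2.2 (by omega) (by omega) (by omega)
      (by rw [lBM_eq_of_lt hb]; omega) hb
  · -- form C: letters `(b, c, a)`, middle letter `c`
    unfold AggV.tloC aggV at hlo; unfold AggV.thiC aggV at hhi; simp only [aggOf] at hlo hhi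
    have hb : ∀ x ∈ G, x.2.2 < t := fun x hx => by have := (h.sides_le hR hx).2.2; omega
    have h1 := h.sbc_le; have h2 := h.sca_le; have h3 := h.lc_le
    have hc := budget_coreG hGM.2.2 (by rw [pcaM_rotC]; exact hpk.1) (by omega)
      (by rw [pabM_rotC]; omega) (by rw [pbcM_rotC]; omega)
      (by rw [lBM_eq_of_lt (mem_rotC_lt hb), lbM_rotC]; omega) (mem_rotC_lt hb)
    rw [pabM_rotC, pbcM_rotC, pcaM_rotC, svM_rotC] at hc
    nlinarith [hc]

/-- **the U11-P budget** (Δ4, prime orders): for every gated `t`, the tail's packing weight is below `qP1` -/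
theorem AboveV.tail_uu_le_qP1 (h : AboveV M G fam) (hp : M.Prime) {R : List Sh}
    (hR : ∀ x ∈ G - famT fam, shOfV M x ∈ R) {t : ℕ} (ht : (aggV M fam).tokP (headD (sufDec R)) t = true) :
    ((G - famT fam).map uu).sum ≤ (aggV M fam).qP1 (headD (sufDec R)) M t := by
  unfold AggV.tokP aggV at ht
  simp only [aggOf, Bool.and_eq_true, Bool.or_eq_true, decide_eq_true_eq] at ht
  obtain ⟨hms, hr⟩ := ht
  refine h.tail_uu_of_coreP hR hms ?_
  have hPM := h.vpG.2 hp
  have hpk := h.adm.1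
  -- a nonempty prefix (else no `t` is gated)
  rcases fam.eq_nil_or_concat' with hfe | ⟨L, s, hfe⟩
  · exfalso; subst hfe; simp [sab, sbc, sca] at hr; omega
  have hs : s ∈ fam := by rw [hfe]; simp
  have hpos := h.one_le_pcaM hs
  rcases hr with (⟨hlo, hhi⟩ | ⟨hlo, hhi⟩) | ⟨hlo, hhi⟩
  · have hb : ∀ x ∈ G, x.1 < t := fun x hx => by have := (h.sides_le hR hx).1; omega
    have h1 := h.sab_le; have h2 := h.sca_le
    have hpos' : 1 ≤ pbcM G := by
      have hx := h.mem_G hs; obtain ⟨-, hb', hc'⟩ := (h.univ _ hx).pos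
      have : pbc s.tr ≤ pbcM G := Multiset.le_sum_of_mem (Multiset.mem_map_of_mem pbc hx)
      unfold pbc at this; nlinarith
    have hc := budget_coreP hPM.2.1 (by rw [pcaM_rotA]; exact hpk.2.1) (by rw [pcaM_rotA]; exact hpos')
      (by omega) (by rw [pabM_rotA]; omega) (by rw [pbcM_rotA]; omega) (mem_rotA_lt hb)
    rw [pabM_rotA, pbcM_rotA, pcaM_rotA, svM_rotA] at hc
    nlinarith [hc]
  · have hb : ∀ x ∈ G, x.2.1 < t := fun x hx => by have := (h.sides_le hR hx).2.1; omega
    have h1 := h.sab_le; have h2 := h.sbc_le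
    exact budget_coreP hPM.1 hpk.2.2 hpos (by omega) (by omega) (by omega) hb
  · have hb : ∀ x ∈ G, x.2.2 < t := fun x hx => by have := (h.sides_le hR hx).2.2; omega
    have h1 := h.sbc_le; have h2 := h.sca_le
    have hpos' : 1 ≤ pabM G := by
      have hx := h.mem_G hs; obtain ⟨ha', hb', -⟩ := (h.univ _ hx).pos
      have : pab s.tr ≤ pabM G := Multiset.le_sum_of_mem (Multiset.mem_map_of_mem pab hx)
      unfold pab at this; nlinarith
    have hc := budget_coreP hPM.2.2 (by rw [pcaM_rotC]; exact hpk.1) (by rw [pcaM_rotC]; exact hpos')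
      (by omega) (by rw [pabM_rotC]; omega) (by rw [pbcM_rotC]; omega) (mem_rotC_lt hb)
    rw [pabM_rotC, pbcM_rotC, pcaM_rotC, svM_rotC] at hc
    nlinarith [hc]

/-- **The vP packing budget.** The tail's packing weight `Σ(ab+bc+ca)` of any vP-admissible family above the prefix,
whose tail lies in the pool `R`, is at most `qTot` (eng-2's `q0`, sharpened by every gated U11-G / U11-P budget). -/
theorem AboveV.tail_uu_le_qTot (h : AboveV M G fam) {R : List Sh} (hR : ∀ x ∈ G - famT fam, shOfV M x ∈ R)
    {isP : Bool} (hP : isP = true → M.Prime) :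
    ((G - famT fam).map uu).sum ≤ (aggV M fam).qTot (headD (sufDec R)) M isP := by
  unfold AggV.qTot
  exact le_budget_fold isP _ _ _ _ (fun t hi ht => h.tail_uu_le_qP1 (hP hi) hR ht)
    (fun t _ ht => h.tail_uu_le_qG1 hR ht) _ _ h.tail_uu

end budget

end Summit.MatrixMultiplication.MatrixMultiplication.Theorems.VPCert
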